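import Summits.Schanuel.Schanuel.Theorems.DiophantineDichotomyDefs

/-!
# Negative lemma for crux `KhovanskiiApproxType` (stmt-Schanuel-6116): the constants are not uniform

Sibling of `Negative/LoadBearing.lean`; vocabulary `IsFreeKhovanskii`, `ApproxTypeAt` imported from the line
lead's definitions module `Theorems/DiophantineDichotomyDefs.lean` (namespace `…LwSmallHeight`).
`not_khovanskiiApproxTypeUniform`: in the crux `∃ a b C` necessarily depends on the point — the free
Khovanskii points `s_k = (x_k, √2·x_k)` with `k·x_k·e^{x_k} = 1` (`0 < x_k ≤ 1/k`; Khovanskii system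
`k z₁ y₁ − 1 = 0`, `z₂² − 2 z₁² = 0` over `ℚ`, exponential Jacobian `2√2·k·x(1+x)eˣ ≠ 0`; `(x, √2 x)` is
`ℚ`-linearly independent by the irrationality of `√2`) accumulate at the ALGEBRAIC point `(0, 0, 1, 1)`,
which is an admissible challenger with budget `d = H = 1`, at distance `≤ 2√2/k < e^{−C}` from
`θ_k = (x_k, √2x_k, e^{x_k}, e^{√2 x_k})` for `k > 3e^{C}`. So any proof of the crux produces a constant
`C(θ)` that blows up as `θ` approaches algebraic points (here along a degenerating Lambert family).
-/

noncomputable section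

set_option linter.dupNamespace false

namespace Summit.Schanuel.Schanuel.Cruxes.KhovanskiiApproxType.Negative

open Summit.Schanuel.Schanuel.Cruxes.KhovanskiiApproxType.LwSmallHeight
open Polynomial


/-- Khovanskii data for `s = (x, √2·x)`, `x > 0` real with `k·x·eˣ = 1` (`k ≥ 1`): the system
`k z₁ y₁ − 1 = 0`, `z₂² − 2 z₁² = 0` has exponential Jacobian `[[k y₁(1+z₁), 0], [−4z₁, 2z₂]]`,
determinant `2√2·k·x(1+x)eˣ ≠ 0`. -/
theorem isFreeKhovanskii_lambert (k : ℕ) (hk : 1 ≤ k) (x : ℝ) (hx : (k : ℝ) * x * Real.exp x = 1)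
    (hx0 : 0 < x) : IsFreeKhovanskii 2 ![(x : ℂ), ((Real.sqrt 2 * x : ℝ) : ℂ)] := by
  classical
  have hxC : (k : ℂ) * (x : ℂ) * Complex.exp (x : ℂ) = 1 := by
    rw [← Complex.ofReal_exp]; exact_mod_cast hx
  have hk0 : (k : ℂ) ≠ 0 := by exact_mod_cast (show k ≠ 0 by omega)
  have hx0C : (x : ℂ) ≠ 0 := by exact_mod_cast hx0.ne'
  have hx1C : (x : ℂ) + 1 ≠ 0 := by
    have : (x + 1 : ℝ) ≠ 0 := by linarith
    exact_mod_cast this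
  have hs2 : ((Real.sqrt 2 : ℝ) : ℂ) ^ 2 = 2 := by
    rw [← Complex.ofReal_pow, Real.sq_sqrt (by norm_num : (0 : ℝ) ≤ 2)]; push_cast; rfl
  have hs0 : ((Real.sqrt 2 : ℝ) : ℂ) ≠ 0 := by
    exact_mod_cast (Real.sqrt_pos.mpr (by norm_num : (0:ℝ) < 2)).ne'
  refine ⟨![MvPolynomial.C (k : ℚ) * MvPolynomial.X (Sum.inl 0) * MvPolynomial.X (Sum.inr 0) - 1,
    MvPolynomial.X (Sum.inl 1) ^ 2 - MvPolynomial.C (2 : ℚ) * MvPolynomial.X (Sum.inl 0) ^ 2], ?_, ?_⟩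
  · intro i
    fin_cases i
    · simp [hxC]
    · simp
      rw [mul_pow, hs2]; ring
  · rw [Matrix.det_fin_two]
    simp [Matrix.of_apply, MvPolynomial.pderiv_X, Derivation.leibniz]
    refine ⟨?_, ?_⟩
    · have : Complex.exp ↑x * ↑k + Complex.exp ↑x * (↑k * ↑x) = ↑k * Complex.exp ↑x * (↑x + 1) := by
        ring
      rw [this]
      exact mul_ne_zero (mul_ne_zero hk0 (Complex.exp_ne_zero _)) hx1C
    · exact hx0.ne'

/-- `(x, √2 x)` is ℚ-linearly independent for real `x ≠ 0` (irrationality of `√2`). -/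
theorem linearIndependent_lambert (x : ℝ) (hx0 : x ≠ 0) :
    LinearIndependent ℚ ![(x : ℂ), ((Real.sqrt 2 * x : ℝ) : ℂ)] := by
  rw [LinearIndependent.pair_iff]
  intro s t hst
  have h1 : ((s : ℝ) + (t : ℝ) * Real.sqrt 2) * x = 0 := by
    have : ((((s : ℝ) + (t : ℝ) * Real.sqrt 2) * x : ℝ) : ℂ) = 0 := by
      push_cast
      rw [Rat.smul_def, Rat.smul_def] at hst
      push_cast at hst
      linear_combination hst
    exact_mod_cast this
  have h2 : (s : ℝ) + (t : ℝ) * Real.sqrt 2 = 0 := by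
    rcases mul_eq_zero.mp h1 with h | h
    · exact h
    · exact absurd h hx0
  by_cases ht : t = 0
  · subst ht
    simp at h2
    exact ⟨by exact_mod_cast h2, rfl⟩
  · exfalso
    have : Real.sqrt 2 = ((-s / t : ℚ) : ℝ) := by
      have ht' : (t : ℝ) ≠ 0 := by exact_mod_cast ht
      push_cast
      field_simp
      linarith
    exact irrational_sqrt_two.ne_rat _ this

/-- For `k ≥ 1` the equation `k x eˣ = 1` has a root `0 < x ≤ 1/k` (intermediate value theorem). -/
theorem exists_lambert (k : ℕ) (hk : 1 ≤ k) :
    ∃ x : ℝ, 0 < x ∧ x ≤ 1 / k ∧ (k : ℝ) * x * Real.exp x = 1 := by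
  have hk' : (1 : ℝ) ≤ k := by exact_mod_cast hk
  have hcont : ContinuousOn (fun x : ℝ => (k : ℝ) * x * Real.exp x) (Set.Icc 0 1) := by
    fun_prop
  have h0 : (fun x : ℝ => (k : ℝ) * x * Real.exp x) 0 ≤ 1 := by simp
  have h1 : (1 : ℝ) ≤ (fun x : ℝ => (k : ℝ) * x * Real.exp x) 1 := by
    simp only [mul_one]
    nlinarith [Real.add_one_le_exp (1 : ℝ)]
  obtain ⟨x, ⟨hx0, hx1⟩, hx⟩ :=
    intermediate_value_Icc (zero_le_one) hcont ⟨h0, h1⟩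
  simp only at hx
  have hxpos : 0 < x := by
    rcases hx0.lt_or_eq with h | h
    · exact h
    · subst h; simp at hx
  refine ⟨x, hxpos, ?_, hx⟩
  rw [div_eq_mul_inv, one_mul, le_inv_comm₀ hxpos (by linarith)]
  -- k ≤ 1/x  since  1 = k x eˣ ≥ k x
  rw [inv_eq_one_div, le_div_iff₀ hxpos]
  nlinarith [Real.add_one_le_exp x, mul_nonneg (by linarith : (0:ℝ) ≤ k) hxpos.le]

/-- The crux with constants UNIFORM in the point (natural strengthening). -/
def KhovanskiiApproxTypeUniform : Prop :=
  ∀ n : ℕ, 2 ≤ n → ∃ a b C : ℝ, a < 1 / ((n : ℝ) - 1) ∧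
    ∀ s : Fin n → ℂ, LinearIndependent ℚ s → IsFreeKhovanskii n s → ApproxTypeAt n s a b C

set_option maxHeartbeats 400000 in
/-- **The constants `(a, b, C)` cannot be chosen uniformly in the point** (tightness): the free
Khovanskii points `s_k = (x_k, √2 x_k)`, `k x_k e^{x_k} = 1` (`0 < x_k ≤ 1/k`), accumulate at the
ALGEBRAIC point `(0, 0, 1, 1)`, an admissible challenger with `d = H = 1`, whose distance to
`θ_k = (x_k, √2 x_k, e^{x_k}, e^{√2 x_k})` is `≤ 2√2/k < e^{−C}` for large `k`. [folklore] -/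
theorem not_khovanskiiApproxTypeUniform : ¬ KhovanskiiApproxTypeUniform := by
  intro h
  obtain ⟨a, b, C, -, hall⟩ := h 2 le_rfl
  -- the constant C of the uniform type (positivity is part of ApproxTypeAt at any point)
  set k : ℕ := ⌈3 * Real.exp C⌉₊ + 2 with hkdef
  have hk1 : 1 ≤ k := by omega
  have hk2 : (2 : ℝ) ≤ k := by exact_mod_cast (show 2 ≤ k by omega)
  have hkC : 3 * Real.exp C < k := by
    have := Nat.le_ceil (3 * Real.exp C)
    have h' : (⌈3 * Real.exp C⌉₊ : ℝ) + 2 = (k : ℝ) := by rw [hkdef]; push_cast; ring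
    linarith
  obtain ⟨x, hx0, hxk, hx⟩ := exists_lambert k hk1
  obtain ⟨hC, hAT⟩ := hall _ (linearIndependent_lambert x hx0.ne') (isFreeKhovanskii_lambert k hk1 x hx hx0)
  -- challenger (0,0,1,1), budget d = H = 1
  have key := hAT 1 1 (Sum.elim ![0, 0] ![1, 1]) ?_ ?_
  · -- distance bound
    have hkpos : (0 : ℝ) < k := by linarith
    have hx1 : x ≤ 1 := hxk.trans (by rw [div_le_one hkpos]; linarith)
    have hsx : Real.sqrt 2 * x ≤ Real.sqrt 2 / k := by
      rw [div_eq_mul_one_div]; exact mul_le_mul_of_nonneg_left hxk (Real.sqrt_nonneg _)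
    have hs2 : Real.sqrt 2 < 3 / 2 := by
      rw [Real.sqrt_lt' (by norm_num)]; norm_num
    have hs1 : 1 < Real.sqrt 2 := by
      rw [Real.lt_sqrt (by norm_num)]; norm_num
    have hsxpos : 0 < Real.sqrt 2 * x := by positivity
    have hsx1 : Real.sqrt 2 * x ≤ 1 := by
      calc Real.sqrt 2 * x ≤ Real.sqrt 2 / k := hsx
        _ ≤ Real.sqrt 2 / 2 := by gcongr
        _ ≤ 1 := by linarith
    have hbound : ‖Sum.elim ![(0 : ℂ), 0] ![1, 1] -
        Sum.elim ![(x : ℂ), ((Real.sqrt 2 * x : ℝ) : ℂ)]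
          (Complex.exp ∘ ![(x : ℂ), ((Real.sqrt 2 * x : ℝ) : ℂ)])‖ ≤ 2 * (Real.sqrt 2 / k) := by
      refine (pi_norm_le_iff_of_nonneg (by positivity)).mpr ?_
      have e1 : |Real.exp x - 1| ≤ 2 * |x| := Real.abs_exp_sub_one_le (by rw [abs_of_pos hx0]; exact hx1)
      have e2 : |Real.exp (Real.sqrt 2 * x) - 1| ≤ 2 * |Real.sqrt 2 * x| :=
        Real.abs_exp_sub_one_le (by rw [abs_of_pos hsxpos]; exact hsx1)
      rw [abs_of_pos hx0] at e1
      rw [abs_of_pos hsxpos] at e2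
      rintro (i | i) <;> fin_cases i
      · simp only [Pi.sub_apply, Sum.elim_inl]
        simp
        rw [abs_of_pos hx0]
        nlinarith
      · simp only [Pi.sub_apply, Sum.elim_inl]
        simp
        rw [abs_of_pos (Real.sqrt_pos.mpr (by norm_num : (0:ℝ) < 2)), abs_of_pos hx0]
        have : 0 ≤ Real.sqrt 2 / k := by positivity
        linarith
      · simp only [Pi.sub_apply, Sum.elim_inr, Function.comp]
        simp
        rw [← Complex.ofReal_exp, ← Complex.ofReal_one, ← Complex.ofReal_sub, Complex.norm_real,
          Real.norm_eq_abs, abs_sub_comm]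
        nlinarith
      · simp only [Pi.sub_apply, Sum.elim_inr, Function.comp]
        simp
        rw [← Complex.ofReal_mul, ← Complex.ofReal_exp, ← Complex.ofReal_one, ← Complex.ofReal_sub,
          Complex.norm_real, Real.norm_eq_abs, abs_sub_comm]
        linarith
    have hlhs : Real.exp (-(C * (((1:ℕ) : ℝ) ^ a * Real.log ((1:ℕ):ℝ) + ((1:ℕ) : ℝ) ^ b))) = Real.exp (-C) := by
      simp
    rw [hlhs] at key
    have hfin : 2 * (Real.sqrt 2 / k) < Real.exp (-C) := by
      have h3k : 3 / (k : ℝ) < Real.exp (-C) := by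
        rw [Real.exp_neg, ← one_div, div_lt_div_iff₀ hkpos (Real.exp_pos C)]
        linarith
      have h22 : 2 * (Real.sqrt 2 / k) < 3 / (k : ℝ) := by
        rw [show 2 * (Real.sqrt 2 / k) = (2 * Real.sqrt 2) / (k : ℝ) by ring]
        exact div_lt_div_of_pos_right (by linarith) hkpos
      linarith
    linarith [key.trans hbound]
  · -- finrank: adjoin {0,1} = ⊥
    have : IntermediateField.adjoin ℚ (Set.range (Sum.elim ![(0:ℂ), 0] ![1, 1])) = ⊥ := by
      rw [← le_bot_iff, IntermediateField.adjoin_le_iff]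
      rintro _ ⟨i, rfl⟩
      rcases i with i | i <;> fin_cases i
      · exact zero_mem _
      · exact zero_mem _
      · exact one_mem _
      · exact one_mem _
    rw [this, IntermediateField.finrank_bot]
  · rintro (i | i) <;> fin_cases i
    · exact ⟨X, X_ne_zero, by simp, fun k => by rw [coeff_X]; split_ifs <;> simp, by simp⟩
    · exact ⟨X, X_ne_zero, by simp, fun k => by rw [coeff_X]; split_ifs <;> simp, by simp⟩
    · refine ⟨X - Polynomial.C 1, X_sub_C_ne_zero 1, by rw [natDegree_X_sub_C], fun k => ?_, by simp⟩
      rw [coeff_sub, coeff_X, coeff_C]; split_ifs <;> simp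
    · refine ⟨X - Polynomial.C 1, X_sub_C_ne_zero 1, by rw [natDegree_X_sub_C], fun k => ?_, by simp⟩
      rw [coeff_sub, coeff_X, coeff_C]; split_ifs <;> simp


end Summit.Schanuel.Schanuel.Cruxes.KhovanskiiApproxType.Negative
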